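import Summits.BirchSwinnertonDyer.BirchSwinnertonDyer.Theses.ShadowIsolation
import Literature.NumberTheory.EllipticCurves.X1ElevenFiveIsogeny
import Literature.NumberTheory.EllipticCurves.X1ElevenMordellWeil
import Literature.NumberTheory.EllipticCurves.MazurTorsionGaloisStructureProofs
import Literature.NumberTheory.EllipticCurves.RationalIsogenyFrobeniusCriterion
import Literature.NumberTheory.EllipticCurves.PointCountEulerCriterion

/-!
# Crux `ShaCotorsionReducible` (stmt-BirchSwinnertonDyer-15277): the Eisenstein sector is inhabited

Negative-side support for the crux `R = Summit.BirchSwinnertonDyer.BirchSwinnertonDyer.Theses.ShadowIsolation.ShaCotorsionReducible`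
(route ShadowIsolation, shared with NormCapitulation), written by the crux disprover
(`refuter-cdisprove-stmt-BirchSwinnertonDyer-15277-0`, cycle 1, 2026-08-17; full record in
`Cruxes/ShaCotorsionReducible/Disproof.lean` §4). `R` says: for `W/ℚ` globally minimal elliptic and a prime
`p ≥ 5` of good ORDINARY reduction at which `E[p]` is REDUCIBLE, `corank_{ℤ_p} Ш(W/ℚ)[p^∞] = 0`.

This file certifies in the kernel that the hypotheses of `R` are JOINTLY SATISFIABLE — the crux is not
vacuously true, so no proof "for lack of instances" and no junk-model proof exists:

* `card_int11A1_mod_five`, `card_int11A3_mod_five` — `#Ẽ(𝔽₅) = 5` for the integer models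
  `[0,-1,1,-10,-20]` of `11A1 = X₀(11)` and `[0,-1,1,0,0]` of `11A3 = X₁(11)` (kernel point counts through
  `WeierstrassCurve.natCard_point_eq_one_add_card` and `card_sol_eq_sum_euler`), i.e. `a₅ = 1`;
* `shaCotorsionReducible_sector_11A1`, `shaCotorsionReducible_sector_11A3` — `(X₀(11), 5)` and
  `(X₁(11), 5)` satisfy every hypothesis of `R`: global minimal equations (the finite check
  `forall_not_pow_dvd_or_of_bound` + `isGloballyMinimal_baseChange_int`), good reduction at `5`
  (`5 ∤ Δ = -11⁵, -11`), ordinary (`a₅ = 1`), `E[5]` reducible (the rational points `(5,5)`, `(0,0)` of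
  order `5` span a `Γ_ℚ`-stable line, `not_hasIrreducibleModPGaloisRep_of_addOrderOf_eq`);
* `shaCotorsionReducible_hypotheses_satisfiable` — hence `¬ (∀ sector, False)`;
* `mordellWeilRank_curve11A3`, `shaCorank_curve11A3_five_eq_zero_iff` — `rank X₁(11)(ℚ) = 0` from the
  tree's Eisenstein `5`-descent `11A3(ℚ) = ⟨(0,0)⟩ ≅ ℤ/5` (`X1Eleven.zmultiples_T_eq_top`), so by
  Greenberg's identity the instance `R(X₁(11), 5)` reads "`Sel_{5^∞}(X₁(11)/ℚ)` is cotorsion": even the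
  smallest instance of the crux is a `5^∞`-Selmer finiteness statement not closed in the tree (true on
  paper: `L(X₁(11),1) ≠ 0`, Kolyvagin–Kato).

Nothing here asserts a Theses statement; theorems only (no definition, no named fact).

## References
* J. E. Cremona, *Algorithms for Modular Elliptic Curves*, 2nd ed. (1997), Table 1, `N = 11`
  (A1 `[0,-1,1,-10,-20]`, A3 `[0,-1,1,0,0]`, `r = 0`, `|T| = 5`, `a₅ = 1`). [CremonaAlgorithms1997]
* B. Mazur, *Modular curves and the Eisenstein ideal*, Publ. Math. IHÉS 47 (1977), Ch. III §5
  (Borel shape of `ρ̄_{E,N}` with rational `N`-torsion; `X₁(11)(ℚ) = ℤ/5`). [Mazur1977]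
* R. Greenberg, LNM 1716 (1999), §1 (`corank Sel_{p^∞} = rank + corank Ш[p^∞]`). [Greenberg1999LNM]
-/

set_option linter.dupNamespace false

noncomputable section

open scoped Classical

namespace Summit.BirchSwinnertonDyer.BirchSwinnertonDyer.Theorems.ShaCotorsionReducible.Negative

open Literature.NumberTheory.EllipticCurves WeierstrassCurve

/-- `#Ẽ(𝔽₅) = 5` (so `a₅ = 5 + 1 - 5 = 1`) for the integer model `[0, -1, 1, -10, -20]` of
`11A1 = X₀(11)`, kernel-decided. [cite: CremonaAlgorithms1997, Table 1, N = 11, curve A1] -/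
theorem card_int11A1_mod_five :
    Nat.card (((⟨0, -1, 1, -10, -20⟩ : WeierstrassCurve ℤ).map (Int.castRingHom (ZMod 5))).toAffine.Point)
      = 5 := by
  rw [@WeierstrassCurve.natCard_point_eq_one_add_card (ZMod 5) (@ZMod.instField 5 ⟨by norm_num⟩) _ _ _
    (by decide +kernel), @card_sol_eq_sum_euler (ZMod 5) (@ZMod.instField 5 ⟨by norm_num⟩) _ _
    (by rw [ZMod.ringChar_zmod_n]; decide), ZMod.card]
  decide +kernel

/-- `#Ẽ(𝔽₅) = 5` (so `a₅ = 1`) for the integer model `[0, -1, 1, 0, 0]` of `11A3 = X₁(11)`,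
kernel-decided. [cite: CremonaAlgorithms1997, Table 1, N = 11, curve A3] -/
theorem card_int11A3_mod_five :
    Nat.card (((⟨0, -1, 1, 0, 0⟩ : WeierstrassCurve ℤ).map (Int.castRingHom (ZMod 5))).toAffine.Point)
      = 5 := by
  rw [@WeierstrassCurve.natCard_point_eq_one_add_card (ZMod 5) (@ZMod.instField 5 ⟨by norm_num⟩) _ _ _
    (by decide +kernel), @card_sol_eq_sum_euler (ZMod 5) (@ZMod.instField 5 ⟨by norm_num⟩) _ _
    (by rw [ZMod.ringChar_zmod_n]; decide), ZMod.card]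
  decide +kernel

/-- **`(X₀(11), 5)` satisfies every hypothesis of the crux.** `[0,-1,1,-10,-20]` over `ℚ` is elliptic
and a GLOBAL MINIMAL equation (`p¹² ∤ Δ = -11⁵` at every prime — the finite check of
`forall_not_pow_dvd_or_of_bound` with `B = 3`), has good reduction at `5` (`5 ∤ Δ`), is ORDINARY there
(`a₅ = 5 + 1 - #Ẽ(𝔽₅) = 1`, `card_int11A1_mod_five`), and `E[5]` is REDUCIBLE: the rational point
`T' = (5,5)` has order `5` (`X1Eleven.five_nsmul_T'`), so `⟨T̄'⟩ ⊂ E[5]` is a `Γ_ℚ`-stable line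
(`not_hasIrreducibleModPGaloisRep_of_addOrderOf_eq`, Mazur's Borel shape `(1 *; 0 χ)`).
[cite: CremonaAlgorithms1997, Table 1, N = 11, curve A1] [cite: Mazur1977, Ch. III §5, p. 157] -/
theorem shaCotorsionReducible_sector_11A1 :
    ∃ (_ : ((⟨0, -1, 1, -10, -20⟩ : WeierstrassCurve ℤ).baseChange ℚ).IsElliptic)
      (_ : ((⟨0, -1, 1, -10, -20⟩ : WeierstrassCurve ℤ).baseChange ℚ).IsGloballyMinimal),
      ((⟨0, -1, 1, -10, -20⟩ : WeierstrassCurve ℤ).baseChange ℚ).HasGoodReductionAtPrime 5 ∧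
      ((⟨0, -1, 1, -10, -20⟩ : WeierstrassCurve ℤ).baseChange ℚ).frobeniusTrace 5 = 1 ∧
      ¬ (5 : ℤ) ∣ ((⟨0, -1, 1, -10, -20⟩ : WeierstrassCurve ℤ).baseChange ℚ).frobeniusTrace 5 ∧
      ¬ ((⟨0, -1, 1, -10, -20⟩ : WeierstrassCurve ℤ).baseChange ℚ).HasIrreducibleModPGaloisRep 5 := by
  set E₀ : WeierstrassCurve ℤ := ⟨0, -1, 1, -10, -20⟩ with hE₀
  -- `11A1 / ℚ` is the base change of its integer model, `Δ(E₀) = -11⁵`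
  have hbc : E₀.baseChange ℚ = X1Eleven.curve11A1 := by
    ext <;> simp [hE₀, X1Eleven.curve11A1, WeierstrassCurve.baseChange, WeierstrassCurve.map]
  have hΔ : E₀.Δ = -11 ^ 5 := by
    rw [hE₀]
    norm_num [WeierstrassCurve.Δ, WeierstrassCurve.b₂, WeierstrassCurve.b₄, WeierstrassCurve.b₆,
      WeierstrassCurve.b₈]
  haveI hE : (E₀.baseChange ℚ).IsElliptic := by rw [hbc]; infer_instance
  haveI hmin : (E₀.baseChange ℚ).IsGloballyMinimal :=
    isGloballyMinimal_baseChange_int E₀ (forall_not_pow_dvd_or_of_bound E₀ (B := 3)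
      (by rw [hE₀]; decide +kernel) (by rw [hΔ]; decide) (by rw [hE₀]; decide +kernel))
  have htr : (E₀.baseChange ℚ).frobeniusTrace 5 = 1 := by
    rw [frobeniusTrace_baseChange_int E₀ card_int11A1_mod_five]; norm_num
  refine ⟨hE, hmin, ?_, htr, by rw [htr]; decide, ?_⟩
  · exact hasGoodReductionAtPrime_baseChange_int E₀ 5 (by rw [hΔ]; decide)
  · rw [hbc]
    exact not_hasIrreducibleModPGaloisRep_of_addOrderOf_eq X1Eleven.curve11A1
      (addOrderOf_eq_prime X1Eleven.five_nsmul_T' X1Eleven.T'_ne_zero)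

/-- **`(X₁(11), 5)` satisfies every hypothesis of the crux** (`[0,-1,1,0,0]`, `Δ = -11`, `a₅ = 1`,
`T = (0,0)` of order `5`, `X1Eleven.addOrderOf_T`).
[cite: CremonaAlgorithms1997, Table 1, N = 11, curve A3] [cite: Mazur1977, Ch. III §5, p. 157] -/
theorem shaCotorsionReducible_sector_11A3 :
    ∃ (_ : ((⟨0, -1, 1, 0, 0⟩ : WeierstrassCurve ℤ).baseChange ℚ).IsElliptic)
      (_ : ((⟨0, -1, 1, 0, 0⟩ : WeierstrassCurve ℤ).baseChange ℚ).IsGloballyMinimal),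
      ((⟨0, -1, 1, 0, 0⟩ : WeierstrassCurve ℤ).baseChange ℚ).HasGoodReductionAtPrime 5 ∧
      ((⟨0, -1, 1, 0, 0⟩ : WeierstrassCurve ℤ).baseChange ℚ).frobeniusTrace 5 = 1 ∧
      ¬ (5 : ℤ) ∣ ((⟨0, -1, 1, 0, 0⟩ : WeierstrassCurve ℤ).baseChange ℚ).frobeniusTrace 5 ∧
      ¬ ((⟨0, -1, 1, 0, 0⟩ : WeierstrassCurve ℤ).baseChange ℚ).HasIrreducibleModPGaloisRep 5 := by
  set E₀ : WeierstrassCurve ℤ := ⟨0, -1, 1, 0, 0⟩ with hE₀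
  -- `11A3 / ℚ` is the base change of its integer model, `Δ(E₀) = -11`
  have hbc : E₀.baseChange ℚ = X1Eleven.curve11A3 := by
    ext <;> simp [hE₀, X1Eleven.curve11A3, WeierstrassCurve.baseChange, WeierstrassCurve.map]
  have hΔ : E₀.Δ = -11 := by
    rw [hE₀]
    norm_num [WeierstrassCurve.Δ, WeierstrassCurve.b₂, WeierstrassCurve.b₄, WeierstrassCurve.b₆,
      WeierstrassCurve.b₈]
  haveI hE : (E₀.baseChange ℚ).IsElliptic := by rw [hbc]; infer_instance
  haveI hmin : (E₀.baseChange ℚ).IsGloballyMinimal :=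
    isGloballyMinimal_baseChange_int E₀ (forall_not_pow_dvd_or_of_bound E₀ (B := 2)
      (by rw [hE₀]; decide +kernel) (by rw [hΔ]; decide) (by rw [hE₀]; decide +kernel))
  have htr : (E₀.baseChange ℚ).frobeniusTrace 5 = 1 := by
    rw [frobeniusTrace_baseChange_int E₀ card_int11A3_mod_five]; norm_num
  refine ⟨hE, hmin, ?_, htr, by rw [htr]; decide, ?_⟩
  · exact hasGoodReductionAtPrime_baseChange_int E₀ 5 (by rw [hΔ]; decide)
  · rw [hbc]
    exact not_hasIrreducibleModPGaloisRep_of_addOrderOf_eq X1Eleven.curve11A3 X1Eleven.addOrderOf_T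

/-- **The crux is not vacuously true**: the "strengthening" asserting that the sector hypotheses of
`ShaCotorsionReducible` are contradictory is FALSE, witness `(X₀(11), 5)`.
[cite: CremonaAlgorithms1997, Table 1, N = 11, curve A1] -/
theorem shaCotorsionReducible_hypotheses_satisfiable :
    ¬ ∀ (W : WeierstrassCurve ℚ) [W.IsElliptic] [W.IsGloballyMinimal] (p : ℕ) [Fact p.Prime],
        5 ≤ p → W.HasGoodReductionAtPrime p → ¬ (p : ℤ) ∣ W.frobeniusTrace p →
        ¬ W.HasIrreducibleModPGaloisRep p → False := by
  intro h
  obtain ⟨hE, hmin, hgood, -, hord, hred⟩ := shaCotorsionReducible_sector_11A1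
  exact h _ 5 le_rfl hgood hord hred

/-- **`rank X₁(11)(ℚ) = 0`**: the tree's Eisenstein `5`-descent gives `11A3(ℚ) = ⟨(0,0)⟩ ≅ ℤ/5`
(`X1Eleven.zmultiples_T_eq_top`), a finite group, whose `ℤ`-rank is `0`.
[cite: Mazur1977, Ch. III §5 Cor. (5.3) p. 156] -/
theorem mordellWeilRank_curve11A3 : X1Eleven.curve11A3.mordellWeilRank = 0 := by
  -- `Finite` is instance-free: get it from the computable-instance statement of the tree
  have hfin : Finite X1Eleven.curve11A3.toAffine.Point := by
    have hT : IsOfFinAddOrder X1Eleven.T := by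
      rw [← addOrderOf_pos_iff, X1Eleven.addOrderOf_T]; norm_num
    have hset := hT.finite_zmultiples
    rw [X1Eleven.zmultiples_T_eq_top, AddSubgroup.coe_top] at hset
    exact Set.finite_univ_iff.mp hset
  letI := Classical.decEq ℚ
  haveI := hfin
  haveI : Module.Finite ℤ X1Eleven.curve11A3.toAffine.Point := Module.Finite.of_finite
  unfold WeierstrassCurve.mordellWeilRank
  refine Module.finrank_eq_zero_iff.2 fun x ↦ ⟨(Nat.card X1Eleven.curve11A3.toAffine.Point : ℕ), ?_, ?_⟩
  · exact_mod_cast (Nat.card_pos (α := X1Eleven.curve11A3.toAffine.Point)).ne'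
  · rw [natCast_zsmul]; exact card_nsmul_eq_zero'

/-- **The smallest instance of the crux is a `5^∞`-Selmer finiteness statement.** At `(X₁(11), 5)`,
`corank Ш[5^∞] = 0 ↔ corank Sel_{5^∞} = 0` (rank `0` + Greenberg's identity
`corank Sel_{p^∞} = rank + corank Ш[p^∞]`, tree theorem `selmerCorank_eq_mordellWeilRank_add_holds`).
[cite: Greenberg1999LNM, §1 pp. 54–57] -/
theorem shaCorank_curve11A3_five_eq_zero_iff :
    X1Eleven.curve11A3.shaCorank 5 = 0 ↔ X1Eleven.curve11A3.selmerCorank 5 = 0 := by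
  have hId := X1Eleven.curve11A3.selmerCorank_eq_mordellWeilRank_add_holds 5
  rw [mordellWeilRank_curve11A3] at hId
  omega

end Summit.BirchSwinnertonDyer.BirchSwinnertonDyer.Theorems.ShaCotorsionReducible.Negative

end
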